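/-
Copyright (c) 2026. All rights reserved.
Released under Apache 2.0 license as described in the file LICENSE.
Authors: abc-iut cell, prover seat abc-iut-L4-d2 (gen 6).
-/
import Mathlib.Topology.Algebra.OpenSubgroup
import Mathlib.Topology.Algebra.ContinuousMonoidHom
import Mathlib.Tactic.Group
import HarnessLib

/-!
# Virtual charts of compact groups in a slim, Neukirch–Uchida-rigid group

Pure topological group theory behind the FUNCTORIALITY of `V⊚(−)` in [AbsTopIII] Def 5.1 (ii)/(iii)
(S. Mochizuki, *Topics in absolute anabelian geometry III* [MochizukiAbsTopIII2015], p. 114: "by considering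
valuations on the field `k_NF(Π_X)` one may functorially construct `V⊚(F̄/F)` from `Π_X`"; p. 115: morphisms
of `EA⊚` are "open injections of profinite groups") at the cell's number-field ARITHMETIC SHADOW
(`GaloisTheatersNumberFieldShadow.lean`, abc-iut-L4-d2 g4; census §6 «binder finding»): the interface field
`GlobalAnabelianContext.mapProVal` asks, for EVERY open injection `Π₁ ↪ Π₂` of profinite groups, an
equivariant homeomorphism of pro-sets.  The classical input that makes this possible is the pair

* (NU)   every topological isomorphism between OPEN subgroups of `Γ` is the restriction of an inner
         automorphism of `Γ` (Neukirch–Uchida for `Γ = G_ℚ`, [NSW] (12.2.1), the tree's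
         `NeukirchUchidaProof.existsUnique_forall_eq_conj_of_rows`);
* (SLIM) an element of `Γ` centralising an open subgroup is trivial (`G_ℚ` is slim).

Both enter here as EXPLICIT HYPOTHESES `hNU`, `hslim` on a compact Hausdorff group `Γ` (discharged at
`Γ = G_ℚ` in `ProfiniteVirtualChartsRat.lean`).  A **virtual chart** of a compact group `P` is a continuous
homomorphism `m : P →ₜ* Γ` that is injective with open image on some open subgroup of `P` (we always spell
this hypothesis out: `∃ W, IsOpen W ∧ Set.InjOn m W ∧ IsOpen (m '' W)`; no definition is introduced).
THEOREMS (proof-only file):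

* `isOpen_image_of_le` — an open embedding on `W` stays an open embedding on every open `W' ≤ W`;
* `exists_localEquiv` — the topological isomorphism `W ≃ₜ* m(W)`;
* `exists_conj_of_continuous_injective` — (NU) in graph form: a continuous injection `U ↪ Γ` with open
  range from an open subgroup `U` is conjugation by some `τ ∈ Γ`;
* `conj_of_conj_on_open` — RIGIDITY: if `m' = τ m τ⁻¹` on an open subgroup where `m'` is an open
  embedding, then `m' = τ m τ⁻¹` everywhere (from (SLIM));
* `exists_conj_of_charts` — any two virtual charts of `P` are `Γ`-conjugate;
* `chart_comp_of_openInjective` — virtual charts pull back along open injections `P₁ ↪ P₂`;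
* (sequel `ProfiniteVirtualChartsExtension.lean`: the COMMENSURATOR CONSTRUCTION — charts EXTEND along open
  injections `P₁ ↪ P₂`).

Consequence (used in `GaloisTheatersNumberFieldShadowContext.lean`): «`Π` admits a virtual chart» is
invariant along every morphism of `EA⊚` in both directions, so the number-field shadow of Def 5.1 (ii)
carries a `mapProVal` for ALL extensions.  Classical; nothing here bears on [IUTchIII] Cor. 3.12.
-/

namespace Literature.AnabelianGeometry.AbsoluteAnabelian

namespace VirtualChart

universe u v w

section Embedding

variable {Γ : Type u} [Group Γ] [TopologicalSpace Γ] [T2Space Γ]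
variable {P : Type v} [Group P] [TopologicalSpace P] [IsTopologicalGroup P] [CompactSpace P]

/-- An open embedding on an open subgroup `W` of a compact group restricts to an open embedding on every
open subgroup `W' ≤ W`: `m(W')` is open (it is `m(W)` minus the compact set `m(W ∖ W')`).
[cite: MochizukiAbsTopIII2015, Def 5.1 (iii) p.115] -/
theorem isOpen_image_of_le (m : P →ₜ* Γ) {W W' : Subgroup P} (hW : IsOpen (W : Set P))
    (hinj : Set.InjOn m W) (hopen : IsOpen (m '' W)) (hW' : IsOpen (W' : Set P)) (hle : W' ≤ W) :
    IsOpen (m '' (W' : Set P)) := by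
  have hWc : IsClosed (W : Set P) := W.isClosed_of_isOpen hW
  have hdiff : IsCompact ((W : Set P) \ W') := (hWc.sdiff hW').isCompact
  have himc : IsClosed (m '' ((W : Set P) \ W')) := (hdiff.image m.continuous).isClosed
  have heq : m '' (W' : Set P) = m '' W \ m '' ((W : Set P) \ W') := by
    ext x
    constructor
    · rintro ⟨w, hw, rfl⟩
      refine ⟨⟨w, hle hw, rfl⟩, ?_⟩
      rintro ⟨w₁, ⟨hw₁W, hw₁W'⟩, h⟩
      have : w₁ = w := hinj hw₁W (hle hw) h
      exact hw₁W' (this ▸ hw)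
    · rintro ⟨⟨w, hwW, rfl⟩, hn⟩
      refine ⟨w, ?_, rfl⟩
      by_contra hw'
      exact hn ⟨w, ⟨hwW, hw'⟩, rfl⟩
  rw [heq]
  exact hopen.sdiff himc

/-- The local topological isomorphism `W ≃ₜ* m(W)` of an embedding on a (compact) open subgroup `W`.
[cite: MochizukiAbsTopIII2015, Def 5.1 (iii) p.115] -/
theorem exists_localEquiv (m : P →ₜ* Γ) {W : Subgroup P} (hW : IsOpen (W : Set P))
    (hinj : Set.InjOn m W) :
    ∃ θ : W ≃ₜ* (W.map m.toMonoidHom), ∀ w : W, ((θ w : W.map m.toMonoidHom) : Γ) = m w := by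
  haveI : CompactSpace W := isCompact_iff_compactSpace.mp (W.isClosed_of_isOpen hW).isCompact
  have hbij : Function.Bijective (m.toMonoidHom.subgroupMap W) := by
    refine ⟨?_, m.toMonoidHom.subgroupMap_surjective W⟩
    rintro ⟨a, ha⟩ ⟨b, hb⟩ h
    exact Subtype.ext (hinj ha hb (Subtype.ext_iff.mp h))
  let e₀ : W ≃* W.map m.toMonoidHom := MulEquiv.ofBijective _ hbij
  have hc : Continuous e₀ := (m.continuous.comp continuous_subtype_val).subtype_mk _
  exact ⟨{ e₀ with
      continuous_toFun := hc
      continuous_invFun := Continuous.continuous_symm_of_equiv_compact_to_t2 (f := e₀.toEquiv) hc },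
    fun _ => rfl⟩

end Embedding

section Rigid

variable {Γ : Type u} [Group Γ] [TopologicalSpace Γ] [T2Space Γ]
variable {P : Type v} [Group P] [TopologicalSpace P] [IsTopologicalGroup P] [CompactSpace P]

/-- (NU) in GRAPH FORM: if every topological isomorphism between open subgroups of `Γ` is inner, then
every continuous injective homomorphism `φ : U → Γ` with open range from an open subgroup `U` is
conjugation by some `τ ∈ Γ`. [cite: NeukirchSchmidtWingberg2008, Thm (12.2.1)] -/
theorem exists_conj_of_continuous_injective [IsTopologicalGroup Γ] [CompactSpace Γ]
    (hNU : ∀ (U₁ U₂ : Subgroup Γ), IsOpen (U₁ : Set Γ) → IsOpen (U₂ : Set Γ) → ∀ α : U₁ ≃ₜ* U₂,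
      ∃ τ : Γ, ∀ u : U₁, ((α u : U₂) : Γ) = τ * u * τ⁻¹)
    {U : Subgroup Γ} (hU : IsOpen (U : Set Γ)) (φ : U →ₜ* Γ) (hφ : Function.Injective φ)
    (hφo : IsOpen (Set.range φ)) :
    ∃ τ : Γ, ∀ u : U, φ u = τ * u * τ⁻¹ := by
  haveI : CompactSpace U := isCompact_iff_compactSpace.mp (U.isClosed_of_isOpen hU).isCompact
  have hU₂ : IsOpen ((φ.toMonoidHom.range : Subgroup Γ) : Set Γ) := by
    rw [MonoidHom.coe_range]
    exact hφo
  let e₀ : U ≃* φ.toMonoidHom.range := MonoidHom.ofInjective hφ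
  have hc : Continuous e₀ := φ.continuous.subtype_mk _
  let α : U ≃ₜ* φ.toMonoidHom.range :=
    { e₀ with
      continuous_toFun := hc
      continuous_invFun := Continuous.continuous_symm_of_equiv_compact_to_t2 (f := e₀.toEquiv) hc }
  obtain ⟨τ, hτ⟩ := hNU U _ hU hU₂ α
  exact ⟨τ, fun u => hτ u⟩

/-- RIGIDITY from slimness: if `m'` is an open embedding on the open subgroup `W` and `m' = τ m τ⁻¹` on
`W`, then `m' p = τ (m p) τ⁻¹` for EVERY `p ∈ P` — both sides induce the same conjugation on the open
subgroup `m'(W ∩ p⁻¹ W p)` of `Γ`. [cite: MochizukiAbsAnab2004, Thm 1.1.1 (ii) p.6] -/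
theorem conj_of_conj_on_open
    (hslim : ∀ (U : Subgroup Γ), IsOpen (U : Set Γ) → ∀ x : Γ, (∀ u ∈ U, x * u * x⁻¹ = u) → x = 1)
    (m : P →* Γ) (m' : P →ₜ* Γ) {W : Subgroup P} (hW : IsOpen (W : Set P)) (hinj : Set.InjOn m' W)
    (hopen : IsOpen (m' '' W)) {τ : Γ} (hτ : ∀ w ∈ W, m' w = τ * m w * τ⁻¹) (p : P) :
    m' p = τ * m p * τ⁻¹ := by
  -- the open subgroup `W_p = W ∩ p⁻¹ W p`
  let Wp : Subgroup P := W ⊓ W.comap (MulAut.conj p).toMonoidHom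
  have hWp : IsOpen (Wp : Set P) := by
    have hc : Continuous fun w : P => p * w * p⁻¹ := by fun_prop
    have : (Wp : Set P) = (W : Set P) ∩ (fun w : P => p * w * p⁻¹) ⁻¹' (W : Set P) := rfl
    rw [this]
    exact hW.inter (hW.preimage hc)
  have hUo : IsOpen ((Wp.map m'.toMonoidHom : Subgroup Γ) : Set Γ) := by
    rw [Subgroup.coe_map]
    exact isOpen_image_of_le m' hW hinj hopen hWp inf_le_left
  set x : Γ := (τ * m p * τ⁻¹)⁻¹ * m' p with hx
  have key : ∀ u ∈ (Wp.map m'.toMonoidHom : Subgroup Γ), x * u * x⁻¹ = u := by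
    rintro _ ⟨w, hw, rfl⟩
    have hwW : w ∈ W := hw.1
    have hcw : p * w * p⁻¹ ∈ W := hw.2
    have h1 : m' (p * w * p⁻¹) = τ * m (p * w * p⁻¹) * τ⁻¹ := hτ _ hcw
    have h2 : m' w = τ * m w * τ⁻¹ := hτ _ hwW
    simp only [map_mul, map_inv] at h1
    change x * m' w * x⁻¹ = m' w
    calc x * m' w * x⁻¹
        = (τ * m p * τ⁻¹)⁻¹ * (m' p * m' w * (m' p)⁻¹) * (τ * m p * τ⁻¹) := by
          rw [hx]; group
      _ = (τ * m p * τ⁻¹)⁻¹ * (τ * (m p * m w * (m p)⁻¹) * τ⁻¹) * (τ * m p * τ⁻¹) := by rw [h1]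
      _ = τ * m w * τ⁻¹ := by group
      _ = m' w := h2.symm
  have hx1 : x = 1 := hslim _ hUo x key
  rw [hx] at hx1
  exact (inv_mul_eq_one.mp hx1).symm

/-- UNIQUENESS UP TO CONJUGATION: any two virtual charts `m, m' : P →ₜ* Γ` of a compact group are
conjugate by an element of `Γ`. [cite: NeukirchSchmidtWingberg2008, Thm (12.2.1)] -/
theorem exists_conj_of_charts
    (hNU : ∀ (U₁ U₂ : Subgroup Γ), IsOpen (U₁ : Set Γ) → IsOpen (U₂ : Set Γ) → ∀ α : U₁ ≃ₜ* U₂,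
      ∃ τ : Γ, ∀ u : U₁, ((α u : U₂) : Γ) = τ * u * τ⁻¹)
    (hslim : ∀ (U : Subgroup Γ), IsOpen (U : Set Γ) → ∀ x : Γ, (∀ u ∈ U, x * u * x⁻¹ = u) → x = 1)
    (m m' : P →ₜ* Γ)
    (hm : ∃ W : Subgroup P, IsOpen (W : Set P) ∧ Set.InjOn m W ∧ IsOpen (m '' W))
    (hm' : ∃ W : Subgroup P, IsOpen (W : Set P) ∧ Set.InjOn m' W ∧ IsOpen (m' '' W)) :
    ∃ τ : Γ, ∀ p : P, m' p = τ * m p * τ⁻¹ := by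
  obtain ⟨W, hW, hinj, hop⟩ := hm
  obtain ⟨W', hW', hinj', hop'⟩ := hm'
  let W₀ : Subgroup P := W ⊓ W'
  have hW₀ : IsOpen (W₀ : Set P) := hW.inter hW'
  have hinj₀ : Set.InjOn m W₀ := hinj.mono fun _ h => h.1
  have hinj₀' : Set.InjOn m' W₀ := hinj'.mono fun _ h => h.2
  have hop₀ : IsOpen (m '' (W₀ : Set P)) := isOpen_image_of_le m hW hinj hop hW₀ inf_le_left
  have hop₀' : IsOpen (m' '' (W₀ : Set P)) := isOpen_image_of_le m' hW' hinj' hop' hW₀ inf_le_right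
  obtain ⟨θ, hθ⟩ := exists_localEquiv m hW₀ hinj₀
  obtain ⟨θ', hθ'⟩ := exists_localEquiv m' hW₀ hinj₀'
  have hU₁ : IsOpen ((W₀.map m.toMonoidHom : Subgroup Γ) : Set Γ) := by
    rw [Subgroup.coe_map]; exact hop₀
  have hU₂ : IsOpen ((W₀.map m'.toMonoidHom : Subgroup Γ) : Set Γ) := by
    rw [Subgroup.coe_map]; exact hop₀'
  obtain ⟨τ, hτ⟩ := hNU _ _ hU₁ hU₂ (θ.symm.trans θ')
  have hτW : ∀ w ∈ W₀, m' w = τ * m w * τ⁻¹ := by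
    intro w hw
    have h := hτ (θ ⟨w, hw⟩)
    have h1 : (((θ.symm.trans θ') (θ ⟨w, hw⟩) : W₀.map m'.toMonoidHom) : Γ) = m' w := by
      change (((θ' (θ.symm (θ ⟨w, hw⟩))) : W₀.map m'.toMonoidHom) : Γ) = m' w
      rw [θ.symm_apply_apply]
      exact hθ' ⟨w, hw⟩
    rw [h1, hθ ⟨w, hw⟩] at h
    exact h
  exact ⟨τ, conj_of_conj_on_open hslim m.toMonoidHom m' hW₀ hinj₀' hop₀' hτW⟩

end Rigid

section Pullback

variable {Γ : Type u} [Group Γ] [TopologicalSpace Γ] [T2Space Γ]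
variable {P₁ : Type v} [Group P₁] [TopologicalSpace P₁]
variable {P₂ : Type w} [Group P₂] [TopologicalSpace P₂] [IsTopologicalGroup P₂] [CompactSpace P₂]

/-- Virtual charts PULL BACK along open injections `ι : P₁ ↪ P₂`: `m ∘ ι` is an open embedding on
`ι⁻¹(W)`. [cite: MochizukiAbsTopIII2015, Def 5.1 (iii) p.115] -/
theorem chart_comp_of_openInjective (ι : P₁ →ₜ* P₂) (hι : Function.Injective ι)
    (hιo : IsOpen (Set.range ι)) (m : P₂ →ₜ* Γ)
    (hm : ∃ W : Subgroup P₂, IsOpen (W : Set P₂) ∧ Set.InjOn m W ∧ IsOpen (m '' W)) :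
    ∃ W : Subgroup P₁, IsOpen (W : Set P₁) ∧ Set.InjOn (m.comp ι) W ∧ IsOpen ((m.comp ι) '' W) := by
  obtain ⟨W, hW, hinj, hop⟩ := hm
  refine ⟨W.comap ι.toMonoidHom, hW.preimage ι.continuous, ?_, ?_⟩
  · intro a ha b hb h
    exact hι (hinj ha hb h)
  · have heq : (m.comp ι) '' (W.comap ι.toMonoidHom : Set P₁) =
        m '' ((W ⊓ ι.toMonoidHom.range : Subgroup P₂) : Set P₂) := by
      ext x
      constructor
      · rintro ⟨a, ha, rfl⟩
        exact ⟨ι a, ⟨ha, ⟨a, rfl⟩⟩, rfl⟩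
      · rintro ⟨b, ⟨hb, ⟨a, rfl⟩⟩, rfl⟩
        exact ⟨a, hb, rfl⟩
    rw [heq]
    refine isOpen_image_of_le m hW hinj hop ?_ inf_le_left
    rw [Subgroup.coe_inf, MonoidHom.coe_range]
    exact hW.inter hιo

end Pullback

end VirtualChart

end Literature.AnabelianGeometry.AbsoluteAnabelian
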